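import Literature.NumberTheory.LFunctions.KeiperLiTrend
import Literature.NumberTheory.LFunctions.LiCriterionDirichlet
import Literature.NumberTheory.LFunctions.WeilExplicitDirichlet
import HarnessLib

/-!
# PART F (cell rh-li, theory g7, round 4 companion) — the ARCHIMEDEAN TREND of the Dirichlet
# Li coefficients: `lb_χ(n) = (n/2)(H_n − 1 − log(2π/q)) + (a − 1)/2 + O(1)` (RH-FREE, GRH-FREE)

Ladder RH, row L-D (Dirichlet twins), PROOF-OF-DATA target **T-D2 `LiDirichletTrend`** —
a THEOREM-IN-WAITING (provable today by the method of `Literature/NumberTheory/LFunctions/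
KeiperLiTrend.lean` verbatim), typed from rh-li-eng-5's certified table (HOME/DATA.md § J (S2),
HOME/data/li_dirichlet_lambda_N1000.tsv: 37 primitive characters `q ≤ 13` + `ζ`, `n ≤ 1000`,
40 digits, certified radius `≤ 1.05e-514`, three code-disjoint lineages agreeing to 70 digits).
**Nothing in this file bears on the truth of RH or GRH**: the trend is the Li functional of the
Gamma factor of `ξ(s, χ)` alone; no zero and no value of `L(s, χ)` enters.

## The object

For a Dirichlet character `χ mod q` of parity `a = charParity χ ∈ {0,1}` (`χ(−1) = (−1)^a`) the
completed L-function is `ξ(s, χ) = (q/π)^{(s+a)/2} Γ((s+a)/2) L(s, χ)`; Li's coefficients are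
`λ_χ(n) = (1/(n−1)!) dⁿ/dsⁿ [s^{n−1} log ξ(s, χ)]_{s=1} = n·[zⁿ] log ξ(1/(1−z), χ)` (Li 2004, (2.3);
the tree's `LiDirichlet.liCoeffChar` / `liCoeffCharRe` are the zero-sum forms).  Exactly as for `ζ`
(Bombieri–Lagarias 1999 Thm 2; Voros 2006 §4; tree `KeiperLiTrend.lean`) the logarithm splits
`log ξ(·, χ) = G_χ + log L(·, χ)` with the GAMMA-FACTOR part `G_χ(s) = ((s+a)/2) log(q/π) +
log Γ((s+a)/2)`, `G_χ′(s) = ½ log(q/π) + ½ ψ((s+a)/2)` (`ψ` = digamma), and Li's change of variables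
`s = L := 1/(1−z)` (`liMap`, `m′ = L²`) turns the Li functional of `G_χ` into a Taylor coefficient of

  `𝒜_χ(z) := G_χ′(L)·L² = (½ log(q/π) + ½ ψ((L + a)/2))·L²`,   `L = liMap z`

(`charTrendGen`; compare `ζ`: `𝒜 = L + (−½ log π + ½ ψ(L/2)) L²`, the extra `L` being the polar
factor `s` of `ξ`, absent for `χ ≠ 1`).  The ARCHIMEDEAN TREND is

  `lb_χ(n) := Re 𝒜_χ^{(n−1)}(0) / (n−1)!`   (`charLiTrend χ n`, `n ≥ 1`),

and the ARITHMETIC (oscillating) part is the Li functional of `log L(s, χ)`, written without a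
logarithm through the Taylor coefficients `q_j(χ) := (L′/L)^{(j)}(1, χ)/j!` of the logarithmic
derivative at `s = 1` (`L(1, χ) ≠ 0` for `χ ≠ 1`): `lt_χ(n) := Σ_{j<n} C(n, j+1) Re q_j(χ)`
(`charLiOsc χ n`; for `ζ` this is `KeiperLiTrend`'s `S_n = Σ_{j<n} C(n,j+1) Re q_j`).

## The law (eng-5 § J (S2), all 37 characters, both parities)

  `lb_χ(n) = (n/2)(H_n − 1 − log(2π/q)) + (a − 1)/2 + r_χ(n)`,  `|r_χ(n)|` tiny

(measured `|r| ≈ 1.5e-34` at `n = 1000`, the size of the beyond-all-orders oscillation; `r` depends on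
`χ` only through `a`; `r_even ≡ r_ζ − 0` pattern, `r_odd` of opposite sign).  WHY THE CONSTANT IS
`(a − 1)/2`: Stirling `ψ(w) = Log w − 1/(2w) − 1/(12w²) + …` at `w = (L+a)/2`.  For EVEN `χ` the
elementary part is `ζ`'s (`KeiperLiTrend`, step 3: coefficients `(n/2)(H_n − 1 − log 2π) + 1/2`) with
`log π ↦ log(π/q)` and WITHOUT the polar `+L` — the `−1/(2w)·L²/2 = −L/2` term is no longer
compensated, so `+1/2 ↦ −1/2 = (a−1)/2`.  For ODD `χ` the shift `w = (L+1)/2` restores it: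
`½L² Log(1 + 1/L) = L/2 − 1/4 + …` and `−½ L²/(L+1) = −L/2 + 1/2 − …`, net constant `→ 0 = (a−1)/2`.
Hence the asymptotic constant `c_χ := lim (lb_χ(n) − (n/2) log n)/n = (γ − 1)/2 − ½ log(2π/q)` for BOTH
parities (eng-5: = Lagarias 2007 (1.13) to 9 digits).  ERRATUM recorded by the data (→ rh-columns-lit):
the retracted print Omar–Ouni–Mazhouda 2011 / arXiv:1507.03431 Thm 2 states the constant as
`½(γ − 1) + ½ log(q/π)`, which lacks `−½ log 2`; the certified table excludes it at every `q ≤ 13`.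

TYPED HERE with the SAFE uniform constant `2` (the tree's `ζ` law has `2/π`; the odd-parity
elementary corrections `Σ 2^{−j}`-type are `≤ 3/4` in modulus and the Stirling remainder on
`Re w > 1/4 + a/2` is `≤ 2/π`): a prover may sharpen.  Uniform in `q ≥ 1`, `χ`, `n ≥ 1`; no
primitivity needed (only `q` and `a` enter).

## Targets

* `LiDirichletTrend` (T-D2, RH-FREE THEOREM-IN-WAITING, size M): the displayed law with constant `2`.
* `LiDirichletSplit` (T-D2s, RH-FREE THEOREM-IN-WAITING, size M–L): for primitive `χ`, `q > 1`,
  `n ≥ 1`: `liCoeffCharRe χ n = charLiTrend χ n + charLiOsc χ n` — Li 2004 Thm 2 / (2.3) (the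
  zero sum equals the Li functional of `log ξ(·,χ)`, by Hadamard + the functional equation; tree:
  `LiDirichlet.re_eq_liCoeffCharRe_of_tendsto`, `DirichletLThetaRepresentation.dirichletXi`) followed
  by the change of variables `iteratedDeriv_pow_mul_eq_iteratedDeriv_comp_liMap` of `KeiperLiTrend`.
  This is what books eng-5's `archimedean/arithmetic split` columns against tree objects.

KILL (data side, per instance): one certified `(χ, n)` with `|r_χ(n)| > 2` refutes T-D2 as typed
(none among 38 000 rows).  PROOF route: `KeiperLiTrend.lean` §§ liMap / Cauchy / Stirling verbatim with
`w = (L+a)/2`.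

References: X.-J. Li, *Explicit formulas for Dirichlet and Hecke L-functions*, Illinois J. Math. 48
(2004) 491–503, (2.3), Thm 2 [Li2004]; E. Bombieri, J. C. Lagarias, J. Number Theory 77 (1999), Thm 2
[BombieriLagarias1999]; A. Voros, Math. Phys. Anal. Geom. 9 (2006) §4 [Voros2006]; J. C. Lagarias,
*Li coefficients for automorphic L-functions*, Ann. Inst. Fourier 57 (2007) 1689–1740, (1.13)–(1.15)
[Lagarias2007]; S. Omar, R. Ouni, K. Mazhouda, arXiv:1507.03431 (constant misprinted; see above).
-/

noncomputable section

open Complex Finset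
open scoped ComplexConjugate

set_option linter.dupNamespace false

namespace Summit.RiemannHypothesis.RiemannHypothesis.Theorems.LiTheory

open Literature.NumberTheory.LFunctions Literature.NumberTheory.LFunctions.LiDirichlet

variable {q : ℕ} [NeZero q]

/-- The TREND GENERATING FUNCTION of `χ`: `𝒜_χ(z) = (½ log(q/π) + ½ ψ((L + a)/2))·L²`, `L = liMap z
= 1/(1−z)`, `a = charParity χ` — the Li-variable form of `G_χ′(s)·(ds/dz)`, `G_χ` the logarithm of the
Gamma factor `(q/π)^{(s+a)/2} Γ((s+a)/2)` of `ξ(s, χ)`.  Analytic on the unit disc (`Re L > 1/2`). -/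
def charTrendGen (χ : DirichletCharacter ℂ q) (z : ℂ) : ℂ :=
  ((Real.log ((q : ℝ) / Real.pi) : ℂ) / 2 +
      Complex.digamma ((liMap z + (charParity χ : ℂ)) / 2) / 2) * liMap z ^ 2

/-- The ARCHIMEDEAN TREND `lb_χ(n) := Re 𝒜_χ^{(n−1)}(0)/(n−1)!` of the Dirichlet Li coefficient
`λ_χ(n)` (`n ≥ 1`; at `n = 0` the junk value `Re 𝒜_χ(0)`): the Li functional
`(1/(n−1)!) dⁿ/dsⁿ[s^{n−1} G_χ(s)]_{s=1}` of the Gamma factor (eng-5's column `lb`). -/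
def charLiTrend (χ : DirichletCharacter ℂ q) (n : ℕ) : ℝ :=
  (iteratedDeriv (n - 1) (charTrendGen χ) 0 / ((n - 1).factorial : ℂ)).re

/-- The Taylor coefficients `q_j(χ) := (L′/L)^{(j)}(1, χ)/j!` of the logarithmic derivative of
`L(s, χ)` at `s = 1` (`χ ≠ 1`: `L(1, χ) ≠ 0`, so `L′/L` is analytic there).  For `ζ` the tree's
analogue is `Xiao2020.zetaOneLogDerivCoeff j` (with `ζ₁ = (s−1)ζ`). -/
def charLogDerivCoeff (χ : DirichletCharacter ℂ q) (j : ℕ) : ℂ :=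
  iteratedDeriv j (logDeriv (DirichletCharacter.LFunction χ)) 1 / (j.factorial : ℂ)

/-- The ARITHMETIC (oscillating) part `lt_χ(n) := Σ_{j<n} C(n, j+1) Re q_j(χ)` of `λ_χ(n)` — the Li
functional of `log L(s, χ)` (eng-5's column `lt`; for `ζ`: `KeiperLiTrend`'s `S_n`). -/
def charLiOsc (χ : DirichletCharacter ℂ q) (n : ℕ) : ℝ :=
  ∑ j ∈ Finset.range n, (n.choose (j + 1) : ℝ) * (charLogDerivCoeff χ j).re

/-- The trend MAIN TERM `(n/2)(H_n − 1 − log(2π/q)) + (a − 1)/2`. -/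
def charLiTrendMain (χ : DirichletCharacter ℂ q) (n : ℕ) : ℝ :=
  (n : ℝ) / 2 * ((harmonic n : ℝ) - 1 - Real.log (2 * Real.pi / q)) + ((charParity χ : ℝ) - 1) / 2

/-- **T-D2 `LiDirichletTrend` — RH-FREE, GRH-FREE THEOREM-IN-WAITING (PROOF-OF-DATA, HOME/DATA.md
§ J (S2)).**  Uniformly in the modulus `q ≥ 1`, the character `χ mod q` and `n ≥ 1`:

  `| lb_χ(n) − ( (n/2)(H_n − 1 − log(2π/q)) + (a − 1)/2 ) | ≤ 2`,

`a = charParity χ`.  (Data: the left side is `≤ 0.14` at `n = 1` and `≈ 1.5e-34` at `n = 1000`.)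
PROOF ROUTE: `KeiperLiTrend.abs_keiperLiCoeff_sub_osc_sub_trend_le` verbatim with `w = (L+a)/2`.
KILL: one certified row with `|r| > 2`. [conjecture-status: theorem-in-waiting; cite: Voros2006 §4,
Lagarias2007 (1.13)] -/
@[conjecture] def LiDirichletTrend : Prop :=
  ∀ (q : ℕ) [NeZero q] (χ : DirichletCharacter ℂ q) (n : ℕ), 1 ≤ n →
    |charLiTrend χ n - charLiTrendMain χ n| ≤ 2

/-- **T-D2s `LiDirichletSplit` — RH-FREE THEOREM-IN-WAITING.**  For a primitive character `χ` of
conductor `q > 1` and `n ≥ 1`, Li's coefficient (the tree's absolutely convergent real zero sum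
`liCoeffCharRe χ n = Σ'_ρ m_χ(ρ) Re[1 − (1 − 1/ρ)ⁿ]`) splits as TREND + OSCILLATION:

  `λ_χ(n) = lb_χ(n) + lt_χ(n)`.

PROOF ROUTE: Li 2004 Thm 2 / (2.3) (`λ_χ(n) = (1/(n−1)!) dⁿ/dsⁿ[s^{n−1} log ξ(s,χ)]_{s=1}`, from the
Hadamard product of `ξ(·,χ)` — tree: `dirichletXi`, `DirichletXiConjugation`, `CharZeroSum`) and the
change of variables `KeiperLiTrend.iteratedDeriv_pow_mul_eq_iteratedDeriv_comp_liMap`.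
[conjecture-status: theorem-in-waiting; cite: Li2004 Thm 2, BombieriLagarias1999 Thm 2] -/
@[conjecture] def LiDirichletSplit : Prop :=
  ∀ (q : ℕ) [NeZero q] (χ : DirichletCharacter ℂ q), χ.IsPrimitive → 1 < q → ∀ n : ℕ, 1 ≤ n →
    liCoeffCharRe χ n = charLiTrend χ n + charLiOsc χ n

/-! ## Sanity (definitions compute; nothing is proved about `L`) -/

omit [NeZero q] in
/-- At `n = 1` the trend is `Re 𝒜_χ(0) = ½ log(q/π) + ½ Re ψ((1+a)/2)`. -/
theorem charLiTrend_one (χ : DirichletCharacter ℂ q) :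
    charLiTrend χ 1 = (charTrendGen χ 0).re := by
  simp [charLiTrend]

omit [NeZero q] in
/-- The main term at `n = 1`: `−½ log(2π/q) + (a−1)/2` (`H_1 = 1`). -/
theorem charLiTrendMain_one (χ : DirichletCharacter ℂ q) :
    charLiTrendMain χ 1 = -(Real.log (2 * Real.pi / q)) / 2 + ((charParity χ : ℝ) - 1) / 2 := by
  simp [charLiTrendMain]
  ring

/-- `liMap 0 = 1` (so `𝒜_χ(0) = ½ log(q/π) + ½ ψ((1+a)/2)`). -/
example : liMap 0 = 1 := by simp [liMap]

/-- The oscillating part at `n = 1` is `Re q_0(χ) = Re (L′/L)(1, χ)`. -/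
theorem charLiOsc_one (χ : DirichletCharacter ℂ q) :
    charLiOsc χ 1 = (charLogDerivCoeff χ 0).re := by
  simp [charLiOsc]

omit [NeZero q] in
/-- Even characters: the main-term constant is `−1/2`; odd: `0`. -/
theorem charLiTrendMain_even {χ : DirichletCharacter ℂ q} (h : χ.Even) (n : ℕ) :
    charLiTrendMain χ n =
      (n : ℝ) / 2 * ((harmonic n : ℝ) - 1 - Real.log (2 * Real.pi / q)) - 1 / 2 := by
  simp [charLiTrendMain, charParity_of_even h]
  ring

/-- Odd characters: the main-term constant vanishes. -/
theorem charLiTrendMain_odd {χ : DirichletCharacter ℂ q} (h : χ.Odd) (n : ℕ) :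
    charLiTrendMain χ n = (n : ℝ) / 2 * ((harmonic n : ℝ) - 1 - Real.log (2 * Real.pi / q)) := by
  simp [charLiTrendMain, charParity_of_odd h]

end Summit.RiemannHypothesis.RiemannHypothesis.Theorems.LiTheory

end
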